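import Literature.NumberTheory.EllipticCurves.NewformPeterssonSizeSymmSquareProofs
import Literature.NumberTheory.EllipticCurves.CuspFormLFunctionEulerProductProofs
import HarnessLib

/-!
# The naive symmetric square of a newform of weight `k` on `Γ₀(N)` at the edge of convergence

Topic `Literature/NumberTheory/EllipticCurves`; theorems only (no definition, no named fact).
Weight-`k` companion of `NewformPeterssonSizeSymmSquareProofs.lean` (which is weight `2`, the
case used by Murty 1999 for elliptic curves). For a newform `f = Σ aₙ qⁿ ∈ S_k(Γ₀(N))`
(`IsNewform0`; real coefficients, `IsNewform0.conj_cuspCoeff`) and `q_p = p^{k−1}`: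

* local factors of `∑ ‖aₙ‖² n^{-w}` (`x = p^{-w}`): `1` at `p² ∣ N`; `(1 − ‖a_p‖² x)⁻¹` with
  `‖a_p‖² = p^{k−2}` at `p ∥ N` (Atkin–Lehner: `a_p = −p^{k/2−1} λ(p)`, `λ(p) = ±1`, the tree's
  `IsNewform0.atkinLehnerEigenvalueAt_eq_of_not_dvd`); and at `p ∤ N`, from the Hecke recursion
  `a_{p^{e+2}} = a_p a_{p^{e+1}} − p^{k−1} a_{p^e}` (`IsNewform0.cuspCoeff_prime_pow_add_two_weight`),
  `∑_e a_{p^e}² x^e = (1 + q_p x)/((1 − q_p x)(1 − (a_p² − 2q_p) x + q_p² x²))` — the cubic being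
  positive at `x = p^{-w}`, `w > k`, with no Ramanujan bound
  (`IsNewform0.tsum_normSq_cuspCoeff_prime_pow_mul_eq_weight`, `…_inv_pos_weight`);
* `summable_normSq_cuspCoeff_div_rpow_weight` (`w > k ≥ 0`, Rankin–Selberg range and comparison),
  `IsNewform0.hasProd_tsum_normSq_cuspCoeff_prime_pow_weight`,
  `IsNewform0.hasProd_rankinSelberg_localFactor_weight` (Euler product with closed factors);
* `IsNewform0.hasProd_symmSq_weight` — for `w > k` the good-prime product of the naive
  symmetric-square factors converges to
  `(∑ ‖aₙ‖² n^{-w}) ∏_{p∣N}(1 − ‖a_p‖² p^{-w}) ζ_N(2w − 2k + 2)/ζ_N(w − k + 1)`;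
* `IsNewform0.tendsto_tprod_symmSq_weight` — **as `w → k⁺` (`k ≥ 1`) that product tends to
  `((4π)^k π/(2 Γ(k) N)) ∏_{p ∥ N}(1 − p^{-2}) Re(f, f)`** (the weight-`k` Rankin–Selberg residue
  `tendsto_sub_weight_mul_tsum_normSq_cuspCoeff_div_rpow`, `(s − 1)ζ(s) → 1`, `ζ(2) = π²/6`,
  `[SL₂(ℤ):Γ₀(N)] = N∏_{p∣N}(1 + 1/p)`); at `k = 2` this is `8π³/N ∏(1 − p^{-2}) Re(f,f)`.
  In particular the edge value lies in `π^{k+1} (f, f) ℚ` (Sturm 1980 / Zagier 1977 for the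
  continued `L(k, Sym² f)`; here for the naive right-limit, unconditionally).

## References

* D. Bump, *Automorphic forms and representations* (1997), §1.6, (6.21), Thm. 1.6.2, Thm. 1.6.3
  (PDF p. 72); §3.9 (PDF p. 382). [Bump1997]
* R. A. Rankin, Proc. Cambridge Philos. Soc. 35 (1939). [Rankin1939]
* A. O. L. Atkin, J. Lehner, *Hecke operators on Γ₀(m)*, Math. Ann. 185 (1970), Thm. 3.
  [AtkinLehner1970]
* A. W. Knapp, *Elliptic curves* (1993), Thm. 9.27. [Knapp1993]
* M. R. Murty, *Bounds for congruence primes* (1999), §2 (the weight-`2` use). [Murty1999CongruencePrimes]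
-/

noncomputable section

open scoped MatrixGroups ModularForm Real Topology
open Filter CongruenceSubgroup

namespace Literature.NumberTheory.EllipticCurves.ModularForms

variable {N : ℕ} [NeZero N] {k : ℤ} {f : CuspForm (Gamma0 N) k}

section CoefficientsWeight

/-- Prime-power recursion on real parts, weight `k`:
`a_{p^{e+2}} = a_p a_{p^{e+1}} − 𝟙_N(p) p^{k−1} a_{p^e}` (`IsNewform0.cuspCoeff_prime_pow_add_two_weight`,
real coefficients). [folklore] -/
theorem IsNewform0.re_cuspCoeff_prime_pow_add_two_weight (hf : IsNewform0 f) {p : ℕ} (hp : p.Prime)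
    (e : ℕ) :
    (cuspCoeff f (p ^ (e + 2))).re = (cuspCoeff f p).re * (cuspCoeff f (p ^ (e + 1))).re -
      (if p ∣ N then 0 else (p : ℝ) ^ (k - 1)) * (cuspCoeff f (p ^ e)).re := by
  have h := hf.cuspCoeff_prime_pow_add_two_weight hp e
  rw [h, Complex.sub_re, Complex.mul_re, hf.cuspCoeff_im_eq_zero p, zero_mul, sub_zero]
  congr 1
  split_ifs
  · simp
  · rw [show ((p : ℂ) ^ (k - 1)) = (((p : ℝ) ^ (k - 1) : ℝ) : ℂ) by push_cast; rfl,
      Complex.re_ofReal_mul]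

/-- At a prime `p ∣ N`, any weight: `a_{p^e}(f) = a_p(f)^e` (`a_{p^{e+2}} = a_p a_{p^{e+1}}` when
`p ∣ N`); private weight-`k` twin of `IsNewform0.cuspCoeff_prime_pow_of_dvd`. [folklore] -/
private theorem IsNewform0.cuspCoeff_prime_pow_of_dvd_weight (hf : IsNewform0 f) {p : ℕ} (hp : p.Prime)
    (hpN : p ∣ N) (e : ℕ) : cuspCoeff f (p ^ e) = cuspCoeff f p ^ e := by
  induction e using Nat.strong_induction_on with
  | _ e ih =>
    match e with
    | 0 => rw [pow_zero, pow_zero]; exact hf.2.2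
    | 1 => rw [pow_one, pow_one]
    | e + 2 =>
      rw [hf.cuspCoeff_prime_pow_add_two_weight hp e, if_pos hpN, ih (e + 1) (by omega), zero_mul,
        sub_zero]
      ring

/-- At a prime `p ∥ N` (`p ∣ N`, `p² ∤ N`), weight `k`: `‖a_p(f)‖² = p^{k−2}` (Atkin–Lehner 1970,
Thm. 3 / Knapp 1993, Thm. 9.27: `a_p = −p^{k/2−1} λ(p)` with `λ(p) = ±1`; the tree's
`IsNewform0.atkinLehnerEigenvalueAt_eq_of_not_dvd`). [cite: Knapp1993, Thm. 9.27] -/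
theorem IsNewform0.norm_cuspCoeff_sq_eq_rpow_of_dvd_of_not_sq_dvd (hf : IsNewform0 f) {p : ℕ}
    (hp : p.Prime) (hpN : p ∣ N) (hp2 : ¬ p ^ 2 ∣ N) :
    ‖cuspCoeff f p‖ ^ 2 = (p : ℝ) ^ ((k : ℝ) - 2) := by
  haveI : Fact p.Prime := ⟨hp⟩
  obtain ⟨M, hN⟩ := hpN
  have hpM : ¬ p ∣ M := fun ⟨M', h⟩ ↦ hp2 ⟨M', by rw [hN, h]; ring⟩
  obtain ⟨ε, hε1, hε⟩ := hf.exists_atkinLehnerInvolutionAt_eq_smul_of_not_dvd p hN hpM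
  have hf0 : f ≠ 0 := IsNormalized.ne_zero_gamma0 hf.2.2
  have h1 : atkinLehnerEigenvalueAt f p = ε := atkinLehnerEigenvalueAt_eq_of_eq_smul hf0 hε
  have h2 := hf.atkinLehnerEigenvalueAt_eq_of_not_dvd p hN hpM
  change atkinLehnerEigenvalueAt f p = -((((p : ℝ) ^ (1 - (k : ℝ) / 2) : ℝ) : ℂ)) * cuspCoeff f p
    at h2
  have hp0 : (0 : ℝ) < p := by exact_mod_cast hp.pos
  have hc : 0 < (p : ℝ) ^ (1 - (k : ℝ) / 2) := Real.rpow_pos_of_pos hp0 _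
  have hnorm : ‖atkinLehnerEigenvalueAt f p‖ = 1 := by
    rw [h1]; rcases hε1 with rfl | rfl <;> simp
  rw [h2, norm_mul, norm_neg, Complex.norm_real, Real.norm_of_nonneg hc.le] at hnorm
  have ha : ‖cuspCoeff f p‖ = (p : ℝ) ^ ((k : ℝ) / 2 - 1) := by
    have hinv : (p : ℝ) ^ ((k : ℝ) / 2 - 1) = ((p : ℝ) ^ (1 - (k : ℝ) / 2))⁻¹ := by
      rw [← Real.rpow_neg hp0.le]; congr 1; ring
    rw [hinv]
    exact eq_inv_of_mul_eq_one_right hnorm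
  rw [ha, ← Real.rpow_natCast, ← Real.rpow_mul hp0.le]
  congr 1; push_cast; ring

/-- At a prime `p ∣ N`, weight `k`: `‖a_p(f)‖² = 0` if `p² ∣ N` and `= p^{k−2}` if `p ∥ N`
(Atkin–Lehner 1970, Thm. 3). [cite: AtkinLehner1970, Thm. 3] -/
theorem IsNewform0.norm_cuspCoeff_sq_of_dvd_weight (hf : IsNewform0 f) {p : ℕ} (hp : p.Prime)
    (hpN : p ∣ N) :
    ‖cuspCoeff f p‖ ^ 2 = if p ^ 2 ∣ N then 0 else (p : ℝ) ^ ((k : ℝ) - 2) := by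
  split_ifs with h
  · rw [hf.cuspCoeff_eq_zero_of_sq_dvd hp h, norm_zero, zero_pow two_ne_zero]
  · exact hf.norm_cuspCoeff_sq_eq_rpow_of_dvd_of_not_sq_dvd hp hpN h

/-- `‖a_p‖² ≤ p^{k−2}` at a prime `p ∣ N` (weight `k`). [folklore] -/
theorem IsNewform0.norm_cuspCoeff_sq_le_of_dvd (hf : IsNewform0 f) {p : ℕ} (hp : p.Prime)
    (hpN : p ∣ N) : ‖cuspCoeff f p‖ ^ 2 ≤ (p : ℝ) ^ ((k : ℝ) - 2) := by
  rw [hf.norm_cuspCoeff_sq_of_dvd_weight hp hpN]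
  split_ifs
  · exact Real.rpow_nonneg (Nat.cast_nonneg p) _
  · exact le_rfl

/-! ### Local factors of `∑ ‖aₙ‖² n^{-w}` in weight `k` -/

/-- The local factor at a prime `p` with `p² ∣ N` is `1` (any weight; private weight-`k` twin of
`IsNewform0.tsum_normSq_cuspCoeff_prime_pow_of_sq_dvd`). [cite: AtkinLehner1970, Thm. 3] -/
private theorem IsNewform0.tsum_normSq_cuspCoeff_prime_pow_of_sq_dvd_weight (hf : IsNewform0 f) {p : ℕ}
    (hp : p.Prime) (hp2 : p ^ 2 ∣ N) (x : ℝ) :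
    ∑' e : ℕ, ‖cuspCoeff f (p ^ e)‖ ^ 2 * x ^ e = 1 := by
  have hpN : p ∣ N := (dvd_pow_self p two_ne_zero).trans hp2
  have h0 : ∀ e : ℕ, ‖cuspCoeff f (p ^ (e + 1))‖ ^ 2 * x ^ (e + 1) = 0 := fun e ↦ by
    rw [hf.cuspCoeff_prime_pow_of_dvd_weight hp hpN, hf.cuspCoeff_eq_zero_of_sq_dvd hp hp2,
      zero_pow (Nat.succ_ne_zero e), norm_zero, zero_pow two_ne_zero, zero_mul]
  rw [tsum_eq_zero_add' (by simp_rw [h0]; exact summable_zero)]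
  simp_rw [h0, tsum_zero, add_zero, pow_zero, show cuspCoeff f 1 = 1 from hf.2.2, norm_one, one_pow,
    mul_one]

/-- Unified local factor at a bad prime `p ∣ N`, weight `k`:
`∑_e ‖a_{p^e}‖² x^e = (1 − ‖a_p‖² x)⁻¹` for `0 ≤ x` with `‖a_p‖² x < 1` (`‖a_{p^e}‖² = (‖a_p‖²)^e`,
geometric series). [cite: AtkinLehner1970, Thm. 3] -/
theorem IsNewform0.hasSum_normSq_cuspCoeff_prime_pow_of_dvd_weight (hf : IsNewform0 f) {p : ℕ}
    (hp : p.Prime) (hpN : p ∣ N) {x : ℝ} (hx0 : 0 ≤ x) (hx1 : ‖cuspCoeff f p‖ ^ 2 * x < 1) :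
    HasSum (fun e : ℕ ↦ ‖cuspCoeff f (p ^ e)‖ ^ 2 * x ^ e) (1 - ‖cuspCoeff f p‖ ^ 2 * x)⁻¹ := by
  have h1 : ∀ e : ℕ, ‖cuspCoeff f (p ^ e)‖ ^ 2 * x ^ e = (‖cuspCoeff f p‖ ^ 2 * x) ^ e := fun e ↦ by
    rw [hf.cuspCoeff_prime_pow_of_dvd_weight hp hpN e, norm_pow, mul_pow, pow_right_comm]
  simp_rw [h1]
  exact hasSum_geometric_of_lt_one (by positivity) hx1

/-- **The local factor at a good prime `p ∤ N`, weight `k`**: with `a = a_p(f) ∈ ℝ`,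
`q = p^{k−1}` and `c_e = ‖a_{p^e}‖² = a_{p^e}²`, the squares of the solution of
`u_{e+2} = a u_{e+1} − q u_e` satisfy the order-three recursion with roots `α², αβ = q, β²`,
whence, whenever `∑_e c_e x^e` converges, `(∑_e c_e x^e)(1 − q x)(1 − (a² − 2q) x + q² x²) = 1 + q x`
(`= (1 − q²x²)` times the naive symmetric-square Euler factor `((1 − α²x)(1 − αβx)(1 − β²x))⁻¹`;
Bump 1997, §3.9, `L_S(s, π × π) = L_S(s, π, ∨²) L_S(s, π, ∧²)`). [cite: Bump1997, §3.9 (PDF p. 382)] -/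
theorem IsNewform0.tsum_normSq_cuspCoeff_prime_pow_mul_eq_weight (hf : IsNewform0 f) {p : ℕ}
    (hp : p.Prime) (hpN : ¬ p ∣ N) {x : ℝ}
    (hs : Summable fun e : ℕ ↦ ‖cuspCoeff f (p ^ e)‖ ^ 2 * x ^ e) :
    (∑' e : ℕ, ‖cuspCoeff f (p ^ e)‖ ^ 2 * x ^ e) *
        ((1 - (p : ℝ) ^ (k - 1) * x) *
          (1 - (‖cuspCoeff f p‖ ^ 2 - 2 * (p : ℝ) ^ (k - 1)) * x + ((p : ℝ) ^ (k - 1)) ^ 2 * x ^ 2)) =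
      1 + (p : ℝ) ^ (k - 1) * x := by
  obtain ⟨q, hq⟩ : ∃ q : ℝ, (p : ℝ) ^ (k - 1) = q := ⟨_, rfl⟩
  rw [hq]
  obtain ⟨u, hu⟩ : ∃ u : ℕ → ℝ, ∀ e, (cuspCoeff f (p ^ e)).re = u e := ⟨_, fun _ ↦ rfl⟩
  have hc : ∀ e, ‖cuspCoeff f (p ^ e)‖ ^ 2 = u e ^ 2 := fun e ↦ by rw [hf.norm_cuspCoeff_sq, hu]
  have hu0 : u 0 = 1 := by rw [← hu, pow_zero, hf.re_cuspCoeff_one]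
  have hp1 : (cuspCoeff f p).re = u 1 := by rw [← hu 1, pow_one]
  have hA2 : ‖cuspCoeff f p‖ ^ 2 = u 1 ^ 2 := by rw [← hc 1, pow_one]
  have hrec : ∀ e, u (e + 2) = u 1 * u (e + 1) - q * u e := fun e ↦ by
    have h := hf.re_cuspCoeff_prime_pow_add_two_weight hp e
    simp only [if_neg hpN, hu, hp1, hq] at h
    exact h
  have hu2 : u 2 = u 1 ^ 2 - q := by
    have h := hrec 0
    rw [zero_add, zero_add, hu0, mul_one] at h
    rw [h]; ring
  have hsq : ∀ e, u (e + 3) ^ 2 =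
      (u 1 ^ 2 - q) * u (e + 2) ^ 2 - (q * u 1 ^ 2 - q ^ 2) * u (e + 1) ^ 2 + q ^ 3 * u e ^ 2 := by
    intro e
    have h2 : u (e + 2) = u 1 * u (e + 1) - q * u e := hrec e
    have h3 : u (e + 3) = u 1 * u (e + 2) - q * u (e + 1) := hrec (e + 1)
    rw [h3, h2]
    ring
  simp_rw [hc] at hs ⊢
  rw [hA2]
  obtain ⟨S, hS⟩ : ∃ S : ℝ, HasSum (fun e : ℕ ↦ u e ^ 2 * x ^ e) S := ⟨_, hs.hasSum⟩
  rw [hS.tsum_eq]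
  have h1 : HasSum (fun e : ℕ ↦ u (e + 1) ^ 2 * x ^ (e + 1))
      (S - ∑ i ∈ Finset.range 1, u i ^ 2 * x ^ i) := (hasSum_nat_add_iff' 1).mpr hS
  have h2 : HasSum (fun e : ℕ ↦ u (e + 2) ^ 2 * x ^ (e + 2))
      (S - ∑ i ∈ Finset.range 2, u i ^ 2 * x ^ i) := (hasSum_nat_add_iff' 2).mpr hS
  have h3 : HasSum (fun e : ℕ ↦ u (e + 3) ^ 2 * x ^ (e + 3))
      (S - ∑ i ∈ Finset.range 3, u i ^ 2 * x ^ i) := (hasSum_nat_add_iff' 3).mpr hS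
  have hfun : (fun e : ℕ ↦ u (e + 3) ^ 2 * x ^ (e + 3)) = fun e : ℕ ↦
      (u 1 ^ 2 - q) * x * (u (e + 2) ^ 2 * x ^ (e + 2)) -
        (q * u 1 ^ 2 - q ^ 2) * x ^ 2 * (u (e + 1) ^ 2 * x ^ (e + 1)) +
        q ^ 3 * x ^ 3 * (u e ^ 2 * x ^ e) := by
    funext e
    rw [hsq e]
    ring
  have h3' : HasSum (fun e : ℕ ↦ u (e + 3) ^ 2 * x ^ (e + 3))
      ((u 1 ^ 2 - q) * x * (S - ∑ i ∈ Finset.range 2, u i ^ 2 * x ^ i) -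
        (q * u 1 ^ 2 - q ^ 2) * x ^ 2 * (S - ∑ i ∈ Finset.range 1, u i ^ 2 * x ^ i) +
        q ^ 3 * x ^ 3 * S) := by
    rw [hfun]
    exact ((h2.mul_left ((u 1 ^ 2 - q) * x)).sub
      (h1.mul_left ((q * u 1 ^ 2 - q ^ 2) * x ^ 2))).add (hS.mul_left (q ^ 3 * x ^ 3))
  have heq := h3.unique h3'
  simp only [Finset.sum_range_succ, Finset.sum_range_zero, zero_add, pow_zero, pow_one, hu0, hu2,
    one_pow, one_mul] at heq
  linear_combination heq

/-- Positivity of the naive symmetric-square Euler factor at a good prime, weight `k`: for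
`p ∤ N`, `x ≥ 0` with `∑_e ‖a_{p^e}‖² x^e` convergent, `(1 − q x)(1 − (‖a_p‖² − 2q) x + q² x²) > 0`,
`q = p^{k−1}` (it is `(1 + q x)/∑_e ‖a_{p^e}‖² x^e`, the sum being `≥ 1`). [folklore] -/
theorem IsNewform0.symmSqLocalFactor_inv_pos_weight (hf : IsNewform0 f) {p : ℕ} (hp : p.Prime)
    (hpN : ¬ p ∣ N) {x : ℝ} (hx : 0 ≤ x)
    (hs : Summable fun e : ℕ ↦ ‖cuspCoeff f (p ^ e)‖ ^ 2 * x ^ e) :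
    0 < (1 - (p : ℝ) ^ (k - 1) * x) *
      (1 - (‖cuspCoeff f p‖ ^ 2 - 2 * (p : ℝ) ^ (k - 1)) * x + ((p : ℝ) ^ (k - 1)) ^ 2 * x ^ 2) := by
  have h := hf.tsum_normSq_cuspCoeff_prime_pow_mul_eq_weight hp hpN hs
  have hq : 0 ≤ (p : ℝ) ^ (k - 1) := zpow_nonneg (Nat.cast_nonneg p) _
  have hS : 0 < ∑' e : ℕ, ‖cuspCoeff f (p ^ e)‖ ^ 2 * x ^ e := by
    refine lt_of_lt_of_le zero_lt_one ?_
    have h0 : (1 : ℝ) = ‖cuspCoeff f (p ^ 0)‖ ^ 2 * x ^ 0 := by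
      simp [show cuspCoeff f 1 = 1 from hf.2.2]
    rw [h0]
    exact hs.le_tsum 0 fun e _ ↦ by positivity
  have hR : 0 < 1 + (p : ℝ) ^ (k - 1) * x := by positivity
  by_contra hle
  push Not at hle
  have := mul_nonpos_of_nonneg_of_nonpos hS.le hle
  linarith

/-- The good local factor in closed form, weight `k`: for `p ∤ N`, `x ≥ 0` with
`∑_e ‖a_{p^e}‖² x^e` convergent,
`∑_e ‖a_{p^e}‖² x^e = (1 + q x)/((1 − q x)(1 − (‖a_p‖² − 2q) x + q² x²))`, `q = p^{k−1}`.
[cite: Bump1997, §3.9 (PDF p. 382)] -/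
theorem IsNewform0.tsum_normSq_cuspCoeff_prime_pow_of_not_dvd_weight (hf : IsNewform0 f) {p : ℕ}
    (hp : p.Prime) (hpN : ¬ p ∣ N) {x : ℝ} (hx : 0 ≤ x)
    (hs : Summable fun e : ℕ ↦ ‖cuspCoeff f (p ^ e)‖ ^ 2 * x ^ e) :
    ∑' e : ℕ, ‖cuspCoeff f (p ^ e)‖ ^ 2 * x ^ e =
      (1 + (p : ℝ) ^ (k - 1) * x) / ((1 - (p : ℝ) ^ (k - 1) * x) *
        (1 - (‖cuspCoeff f p‖ ^ 2 - 2 * (p : ℝ) ^ (k - 1)) * x + ((p : ℝ) ^ (k - 1)) ^ 2 * x ^ 2)) := by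
  have h := hf.tsum_normSq_cuspCoeff_prime_pow_mul_eq_weight hp hpN hs
  have hQ := hf.symmSqLocalFactor_inv_pos_weight hp hpN hx hs
  rw [eq_div_iff hQ.ne', h]

/-! ### Summability and the Euler product of `∑ ‖aₙ‖² n^{-w}` for `w > k` -/

/-- **`∑ₙ ‖aₙ(f)‖² n^{-w}` converges for every `w > k`**, `f ∈ S_k(Γ₀(N))`, `k ≥ 0` (Rankin 1939;
from the tree's `summable_normSq_cuspCoeff_mul_rpow`, the range `k < w < k + 2`, and comparison
with `w = k + 1` beyond). [cite: Rankin1939, convergence of Σ|aₙ|²n^{-s} for Re s > k] -/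
theorem summable_normSq_cuspCoeff_div_rpow_weight (hk : 0 ≤ k) (f : CuspForm (Gamma0 N) k) {w : ℝ}
    (hw : (k : ℝ) < w) : Summable fun n : ℕ ↦ ‖cuspCoeff f n‖ ^ 2 / (n : ℝ) ^ w := by
  have hk0 : (0 : ℝ) ≤ k := by exact_mod_cast hk
  have key : ∀ w : ℝ, (k : ℝ) < w → w < k + 2 →
      Summable fun n : ℕ ↦ ‖cuspCoeff f n‖ ^ 2 / (n : ℝ) ^ w := by
    intro w hw1 hw2
    have h := summable_normSq_cuspCoeff_mul_rpow hk f (s := w - k + 1) (by linarith) (by linarith)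
    have h' : Summable fun n : ℕ ↦
        ‖cuspCoeff f n‖ ^ 2 * ((1 / (4 * π * n)) ^ w * Real.Gamma w) * ((4 * π) ^ w / Real.Gamma w) := by
      refine (h.mul_right ((4 * π) ^ w / Real.Gamma w)).congr fun n ↦ ?_
      rw [show w - k + 1 + k - 1 = w by ring]
    refine h'.congr fun n ↦ ?_
    have hw0 : 0 < w := by linarith
    have hΓ : Real.Gamma w ≠ 0 := (Real.Gamma_pos_of_pos hw0).ne'
    have h4π : (0 : ℝ) < 4 * π := by positivity
    rcases Nat.eq_zero_or_pos n with rfl | hn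
    · simp [Real.zero_rpow hw0.ne']
    · have hn' : (0 : ℝ) < n := by exact_mod_cast hn
      rw [one_div, Real.inv_rpow (by positivity), Real.mul_rpow h4π.le hn'.le]
      field_simp
  by_cases hw2 : w < k + 2
  · exact key w hw hw2
  · push Not at hw2
    have h3 := key (k + 1) (by linarith) (by linarith)
    refine Summable.of_nonneg_of_le (fun n ↦ by positivity) (fun n ↦ ?_) h3
    rcases Nat.eq_zero_or_pos n with rfl | hn
    · simp [Real.zero_rpow (show (w : ℝ) ≠ 0 by linarith),
        Real.zero_rpow (show ((k : ℝ) + 1) ≠ 0 by linarith)]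
    · have hn' : (1 : ℝ) ≤ n := by exact_mod_cast hn
      exact div_le_div_of_nonneg_left (by positivity) (by positivity)
        (Real.rpow_le_rpow_of_exponent_le hn' (by linarith))

/-- **Euler product of the Rankin–Selberg Dirichlet series of a newform of weight `k ≥ 0`**: for
`w > k`, `∑ₙ ‖aₙ‖² n^{-w} = ∏_p ∑_e ‖a_{p^e}‖² p^{-ew}`.
[cite: Rankin1939, convergence of Σ|aₙ|²n^{-s} for Re s > k] -/
theorem IsNewform0.hasProd_tsum_normSq_cuspCoeff_prime_pow_weight (hk : 0 ≤ k) (hf : IsNewform0 f)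
    {w : ℝ} (hw : (k : ℝ) < w) :
    HasProd (fun p : Nat.Primes ↦ ∑' e : ℕ, ‖cuspCoeff f ((p : ℕ) ^ e)‖ ^ 2 / (((p : ℕ) ^ e : ℕ) : ℝ) ^ w)
      (∑' n : ℕ, ‖cuspCoeff f n‖ ^ 2 / (n : ℝ) ^ w) := by
  have hk0 : (0 : ℝ) ≤ k := by exact_mod_cast hk
  have hw0 : w ≠ 0 := by linarith
  refine EulerProduct.eulerProduct_hasProd (f := fun n : ℕ ↦ ‖cuspCoeff f n‖ ^ 2 / (n : ℝ) ^ w)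
    ?_ ?_ ?_ ?_
  · simp [show cuspCoeff f 1 = 1 from hf.2.2]
  · intro m n hmn
    have h : cuspCoeff f (m * n) = cuspCoeff f m * cuspCoeff f n :=
      IsNewform0.coeff_mul_of_coprime_holds hf hmn
    rw [h, norm_mul, Nat.cast_mul, Real.mul_rpow (Nat.cast_nonneg m) (Nat.cast_nonneg n)]
    ring
  · refine (summable_normSq_cuspCoeff_div_rpow_weight hk f hw).congr fun n ↦ ?_
    rw [Real.norm_of_nonneg (by positivity)]
  · simp [Real.zero_rpow hw0]

omit [NeZero N] in
/-- `‖a_{p^e}‖² / (p^e)^w = ‖a_{p^e}‖² · (p^{-w})^e` (any weight). [folklore] -/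
theorem normSq_cuspCoeff_prime_pow_div_eq_weight (f : CuspForm (Gamma0 N) k) (p e : ℕ) (w : ℝ) :
    ‖cuspCoeff f (p ^ e)‖ ^ 2 / (((p ^ e : ℕ) : ℝ)) ^ w =
      ‖cuspCoeff f (p ^ e)‖ ^ 2 * ((p : ℝ) ^ (-w)) ^ e := by
  have hp : (0 : ℝ) ≤ p := Nat.cast_nonneg p
  rw [div_eq_mul_inv, Nat.cast_pow, ← Real.rpow_natCast (p : ℝ) e, ← Real.rpow_mul hp,
    ← Real.rpow_natCast ((p : ℝ) ^ (-w)) e, ← Real.rpow_mul hp, ← Real.rpow_neg hp]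
  congr 1
  ring

/-- The prime-power subseries `∑_e ‖a_{p^e}‖² (p^{-w})^e` converges (`w > k ≥ 0`, `p` prime).
[folklore] -/
theorem summable_normSq_cuspCoeff_prime_pow_mul_weight (hk : 0 ≤ k) (f : CuspForm (Gamma0 N) k)
    {w : ℝ} (hw : (k : ℝ) < w) {p : ℕ} (hp : p.Prime) :
    Summable fun e : ℕ ↦ ‖cuspCoeff f (p ^ e)‖ ^ 2 * ((p : ℝ) ^ (-w)) ^ e := by
  have h := (summable_normSq_cuspCoeff_div_rpow_weight hk f hw).comp_injective
    (Nat.pow_right_injective hp.two_le)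
  refine h.congr fun e ↦ ?_
  simp only [Function.comp_apply]
  rw [← normSq_cuspCoeff_prime_pow_div_eq_weight f p e w, Nat.cast_pow]

/-- `q · p^{-w} = p^{-(w − k + 1)}` for `q = p^{k−1}` (the rpow form of the weight shift). [folklore] -/
theorem rpow_sub_one_mul_rpow_neg {p : ℕ} (hp : 0 < p) (k : ℤ) (w : ℝ) :
    (p : ℝ) ^ ((k : ℝ) - 1) * (p : ℝ) ^ (-w) = (p : ℝ) ^ (-(w - k + 1)) := by
  have hp' : (0 : ℝ) < p := by exact_mod_cast hp
  rw [← Real.rpow_add hp']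
  congr 1
  ring

/-- `p^{k−1}` in the zpow and rpow forms agree. [folklore] -/
theorem zpow_sub_one_eq_rpow (p : ℕ) (k : ℤ) : (p : ℝ) ^ (k - 1) = (p : ℝ) ^ ((k : ℝ) - 1) := by
  rw [← Real.rpow_intCast]
  push_cast
  ring_nf

/-- **Euler product of `∑ ‖aₙ‖² n^{-w}` in weight `k` with its local factors in closed form**
(`w > k ≥ 0`): `∑ₙ ‖aₙ‖² n^{-w} = ∏_{p∣N}(1 − ‖a_p‖² x_p)⁻¹ · ∏_{p∤N}(1 + q x_p)/((1 − q x_p)(1 − (a_p² − 2q) x_p + q² x_p²))`,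
`x_p = p^{-w}`, `q = p^{k−1}` (Rankin 1939; Shimura 1975; Bump 1997, §3.9).
[cite: Bump1997, §3.9 (PDF p. 382)] -/
theorem IsNewform0.hasProd_rankinSelberg_localFactor_weight (hk : 0 ≤ k) (hf : IsNewform0 f) {w : ℝ}
    (hw : (k : ℝ) < w) :
    HasProd (fun p : Nat.Primes ↦
        if (p : ℕ) ∣ N then (1 - ‖cuspCoeff f p‖ ^ 2 * (p : ℝ) ^ (-w))⁻¹
        else (1 + (p : ℝ) ^ ((k : ℝ) - 1) * (p : ℝ) ^ (-w)) /
          ((1 - (p : ℝ) ^ ((k : ℝ) - 1) * (p : ℝ) ^ (-w)) *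
            (1 - (‖cuspCoeff f p‖ ^ 2 - 2 * (p : ℝ) ^ ((k : ℝ) - 1)) * (p : ℝ) ^ (-w) +
              ((p : ℝ) ^ ((k : ℝ) - 1)) ^ 2 * ((p : ℝ) ^ (-w)) ^ 2)))
      (∑' n : ℕ, ‖cuspCoeff f n‖ ^ 2 / (n : ℝ) ^ w) := by
  refine (hf.hasProd_tsum_normSq_cuspCoeff_prime_pow_weight hk hw).congr_fun fun p ↦ ?_
  have hp : (p : ℕ).Prime := p.2
  have hp0 : (0 : ℝ) < (p : ℕ) := by exact_mod_cast hp.pos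
  have hx0 : (0 : ℝ) ≤ ((p : ℕ) : ℝ) ^ (-w) := Real.rpow_nonneg (Nat.cast_nonneg _) _
  have hs := summable_normSq_cuspCoeff_prime_pow_mul_weight hk f hw hp
  rw [tsum_congr (fun e ↦ normSq_cuspCoeff_prime_pow_div_eq_weight f p e w)]
  split_ifs with hpN
  · refine (hf.hasSum_normSq_cuspCoeff_prime_pow_of_dvd_weight hp hpN hx0 ?_).tsum_eq.symm
    calc ‖cuspCoeff f p‖ ^ 2 * ((p : ℕ) : ℝ) ^ (-w)
        ≤ ((p : ℕ) : ℝ) ^ ((k : ℝ) - 2) * ((p : ℕ) : ℝ) ^ (-w) := by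
          gcongr; exact hf.norm_cuspCoeff_sq_le_of_dvd hp hpN
      _ = ((p : ℕ) : ℝ) ^ ((k : ℝ) - 2 - w) := by rw [← Real.rpow_add hp0]; ring_nf
      _ < 1 := Real.rpow_lt_one_of_one_lt_of_neg (by exact_mod_cast hp.one_lt) (by linarith)
  · rw [← zpow_sub_one_eq_rpow]
    exact (hf.tsum_normSq_cuspCoeff_prime_pow_of_not_dvd_weight hp hpN hx0 hs).symm

end CoefficientsWeight

section SymmSquareWeight

/-- **The naive symmetric-square Euler product of a newform of weight `k ≥ 0`, `w > k`.** For a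
newform `f ∈ S_k(Γ₀(N))` and real `w > k` the product over the primes `p ∤ N` of the inverted
local factors `L_p(Sym² f, p^{-w}) = ((1 − q p^{-w})(1 − (a_p² − 2q) p^{-w} + q² p^{-2w}))⁻¹`,
`q = p^{k−1}` (`= ((1 − α_p² X)(1 − α_pβ_p X)(1 − β_p² X))⁻¹` at `X = p^{-w}`, `α_p + β_p = a_p`,
`α_p β_p = p^{k−1}`), converges, to
`(∑ₙ ‖aₙ‖² n^{-w}) · ∏_{p∣N} (1 − ‖a_p‖² p^{-w}) · ζ_N(2w − 2k + 2) / ζ_N(w − k + 1)`,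
`ζ_N(s) = ζ(s) ∏_{p∣N} (1 − p^{-s})`, `ζ(s) = ∑_{n≥1} n^{-s}` (Rankin 1939; Shimura 1975; level one:
Bump 1997, (6.21) with Thm. 1.6.3, `ζ(2s−2k+2) Σ A(n)² n^{-s} = ζ(s−k+1) L(Sym² f, s)`; the
weight-`2` case is `IsNewform0.hasProd_symmSq`). [cite: Bump1997, §1.6 (6.21), Thm. 1.6.3 (PDF p. 72); §3.9 (PDF p. 382)] -/
theorem IsNewform0.hasProd_symmSq_weight (hk : 0 ≤ k) (hf : IsNewform0 f) {w : ℝ} (hw : (k : ℝ) < w) :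
    HasProd (fun p : Nat.Primes ↦ if (p : ℕ) ∣ N then (1 : ℝ) else
        ((1 - (p : ℝ) ^ ((k : ℝ) - 1) * (p : ℝ) ^ (-w)) *
          (1 - (‖cuspCoeff f p‖ ^ 2 - 2 * (p : ℝ) ^ ((k : ℝ) - 1)) * (p : ℝ) ^ (-w) +
            ((p : ℝ) ^ ((k : ℝ) - 1)) ^ 2 * ((p : ℝ) ^ (-w)) ^ 2))⁻¹)
      ((∑' n : ℕ, ‖cuspCoeff f n‖ ^ 2 / (n : ℝ) ^ w) *
        (∏ p ∈ N.primeFactors, (1 - ‖cuspCoeff f p‖ ^ 2 * (p : ℝ) ^ (-w))) *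
        ((∑' n : ℕ, 1 / (n : ℝ) ^ (2 * w - 2 * k + 2)) * ∏ p ∈ N.primeFactors, (1 - (p : ℝ) ^ (-(2 * w - 2 * k + 2)))) /
        ((∑' n : ℕ, 1 / (n : ℝ) ^ (w - k + 1)) * ∏ p ∈ N.primeFactors, (1 - (p : ℝ) ^ (-(w - k + 1))))) := by
  have hN : N ≠ 0 := NeZero.ne N
  have hk0 : (0 : ℝ) ≤ k := by exact_mod_cast hk
  obtain ⟨S, hS'⟩ := exists_finset_primes_mem_iff_dvd hN
  have hS : ∀ p : Nat.Primes, (p : ℕ) ∣ N ↔ p ∈ S := fun p ↦ (hS' p).symm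
  -- positivity / nonvanishing facts
  have hx0 : ∀ p : Nat.Primes, (0 : ℝ) ≤ ((p : ℕ) : ℝ) ^ (-w) := fun p ↦
    Real.rpow_nonneg (Nat.cast_nonneg _) _
  have hx1 : ∀ p : Nat.Primes, ((p : ℕ) : ℝ) ^ (-w) < 1 := fun p ↦
    Real.rpow_lt_one_of_one_lt_of_neg (by exact_mod_cast p.2.one_lt) (by linarith)
  have hy : ∀ p : Nat.Primes, ((p : ℕ) : ℝ) ^ (-(w - k + 1)) =
      ((p : ℕ) : ℝ) ^ ((k : ℝ) - 1) * ((p : ℕ) : ℝ) ^ (-w) := fun p ↦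
    (rpow_sub_one_mul_rpow_neg p.2.pos k w).symm
  have hy2 : ∀ p : Nat.Primes, ((p : ℕ) : ℝ) ^ (-(2 * w - 2 * k + 2)) =
      (((p : ℕ) : ℝ) ^ ((k : ℝ) - 1) * ((p : ℕ) : ℝ) ^ (-w)) ^ 2 := fun p ↦ by
    have hp : (0 : ℝ) ≤ (p : ℕ) := Nat.cast_nonneg _
    rw [← hy p, ← Real.rpow_natCast, ← Real.rpow_mul hp]
    congr 1; push_cast; ring
  have hylt : ∀ p : Nat.Primes, ((p : ℕ) : ℝ) ^ ((k : ℝ) - 1) * ((p : ℕ) : ℝ) ^ (-w) < 1 := fun p ↦ by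
    rw [← hy p]
    exact Real.rpow_lt_one_of_one_lt_of_neg (by exact_mod_cast p.2.one_lt) (by linarith)
  have hypos : ∀ p : Nat.Primes, 0 < ((p : ℕ) : ℝ) ^ ((k : ℝ) - 1) * ((p : ℕ) : ℝ) ^ (-w) := fun p ↦ by
    rw [← hy p]
    exact Real.rpow_pos_of_pos (by exact_mod_cast p.2.pos) _
  have hbad : ∀ p : Nat.Primes, (p : ℕ) ∣ N → 0 < 1 - ‖cuspCoeff f p‖ ^ 2 * ((p : ℕ) : ℝ) ^ (-w) := by
    intro p hpN
    have hp0 : (0 : ℝ) < (p : ℕ) := by exact_mod_cast p.2.pos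
    have h1 : ‖cuspCoeff f p‖ ^ 2 * ((p : ℕ) : ℝ) ^ (-w) < 1 :=
      calc ‖cuspCoeff f p‖ ^ 2 * ((p : ℕ) : ℝ) ^ (-w)
          ≤ ((p : ℕ) : ℝ) ^ ((k : ℝ) - 2) * ((p : ℕ) : ℝ) ^ (-w) := by
            gcongr; exact hf.norm_cuspCoeff_sq_le_of_dvd p.2 hpN
        _ = ((p : ℕ) : ℝ) ^ ((k : ℝ) - 2 - w) := by rw [← Real.rpow_add hp0]; ring_nf
        _ < 1 := Real.rpow_lt_one_of_one_lt_of_neg (by exact_mod_cast p.2.one_lt) (by linarith)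
    linarith
  have hQ : ∀ p : Nat.Primes, ¬ (p : ℕ) ∣ N → 0 < (1 - ((p : ℕ) : ℝ) ^ ((k : ℝ) - 1) * ((p : ℕ) : ℝ) ^ (-w)) *
      (1 - (‖cuspCoeff f p‖ ^ 2 - 2 * ((p : ℕ) : ℝ) ^ ((k : ℝ) - 1)) * ((p : ℕ) : ℝ) ^ (-w) +
        (((p : ℕ) : ℝ) ^ ((k : ℝ) - 1)) ^ 2 * (((p : ℕ) : ℝ) ^ (-w)) ^ 2) := fun p hpN ↦ by
    rw [← zpow_sub_one_eq_rpow]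
    exact hf.symmSqLocalFactor_inv_pos_weight p.2 hpN (hx0 p)
      (summable_normSq_cuspCoeff_prime_pow_mul_weight hk f hw p.2)
  have hZ1 : 0 < ∑' n : ℕ, 1 / (n : ℝ) ^ (w - k + 1) := tsum_one_div_nat_rpow_pos (by linarith)
  have hZ2 : 0 < ∑' n : ℕ, 1 / (n : ℝ) ^ (2 * w - 2 * k + 2) := tsum_one_div_nat_rpow_pos (by linarith)
  -- (1) the Rankin–Selberg Euler product with its local factors in closed form
  have hE := hf.hasProd_rankinSelberg_localFactor_weight hk hw
  -- (2a) correction at the bad primes (a finite product)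
  have e1 : HasProd (fun p : Nat.Primes ↦
      if (p : ℕ) ∣ N then (1 - ‖cuspCoeff f p‖ ^ 2 * (p : ℝ) ^ (-w))⁻¹ else 1)
      (∏ p ∈ S, (1 - ‖cuspCoeff f p‖ ^ 2 * (p : ℝ) ^ (-w))⁻¹) := by
    have hval : ∏ p ∈ S, (if (p : ℕ) ∣ N then (1 - ‖cuspCoeff f p‖ ^ 2 * (p : ℝ) ^ (-w))⁻¹ else 1) =
        ∏ p ∈ S, (1 - ‖cuspCoeff f p‖ ^ 2 * (p : ℝ) ^ (-w))⁻¹ :=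
      Finset.prod_congr rfl fun p hp ↦ by rw [if_pos ((hS p).mpr hp)]
    rw [← hval]
    exact hasProd_prod_of_ne_finset_one fun p hp ↦ by rw [if_neg (fun h ↦ hp ((hS p).mp h))]
  -- (2b) `∏_{p ∤ N} (1 − p^{-(2w-2k+2)}) = ζ_N(2w − 2k + 2)⁻¹`
  have e2 : HasProd (fun p : Nat.Primes ↦ if (p : ℕ) ∣ N then (1 : ℝ) else (1 - (p : ℝ) ^ (-(2 * w - 2 * k + 2))))
      ((∑' n : ℕ, 1 / (n : ℝ) ^ (2 * w - 2 * k + 2))⁻¹ *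
        ((∏ p ∈ S, (if (p : ℕ) ∣ N then (1 : ℝ) else (1 - (p : ℝ) ^ (-(2 * w - 2 * k + 2))))) /
          ∏ p ∈ S, (1 - (p : ℝ) ^ (-(2 * w - 2 * k + 2))))) := by
    have hz : HasProd (fun p : Nat.Primes ↦ (1 - (p : ℝ) ^ (-(2 * w - 2 * k + 2))))
        (∑' n : ℕ, 1 / (n : ℝ) ^ (2 * w - 2 * k + 2))⁻¹ :=
      (hasProd_inv_of_hasProd (hasProd_one_sub_prime_rpow_neg_inv (s := 2 * w - 2 * k + 2) (by linarith))
        hZ2.ne').congr_fun fun p ↦ (inv_inv _).symm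
    refine hz.congr_cofinite₀ (s := S) (fun p _ ↦ ?_) (fun p hp ↦ ?_)
    · rw [hy2 p]; nlinarith [hylt p, hypos p]
    · rw [if_neg (fun h ↦ hp ((hS p).mp h))]
  -- (2c) `∏_{p ∤ N} (1 − p^{-(w-k+1)})⁻¹ = ζ_N(w − k + 1)`
  have e3 : HasProd (fun p : Nat.Primes ↦ if (p : ℕ) ∣ N then (1 : ℝ) else (1 - (p : ℝ) ^ (-(w - k + 1)))⁻¹)
      ((∑' n : ℕ, 1 / (n : ℝ) ^ (w - k + 1)) *
        ((∏ p ∈ S, (if (p : ℕ) ∣ N then (1 : ℝ) else (1 - (p : ℝ) ^ (-(w - k + 1)))⁻¹)) /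
          ∏ p ∈ S, (1 - (p : ℝ) ^ (-(w - k + 1)))⁻¹)) := by
    refine (hasProd_one_sub_prime_rpow_neg_inv (s := w - k + 1) (by linarith)).congr_cofinite₀ (s := S)
      (fun p _ ↦ ?_) (fun p hp ↦ ?_)
    · rw [hy p]; exact inv_ne_zero (by linarith [hylt p])
    · rw [if_neg (fun h ↦ hp ((hS p).mp h))]
  -- (3) combine: `L_p = E_p · (e1_p e2_p e3_p)⁻¹`
  have hc := (e1.mul e2).mul e3
  set V : ℝ := (∏ p ∈ S, (1 - ‖cuspCoeff f p‖ ^ 2 * (p : ℝ) ^ (-w))⁻¹) *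
      ((∑' n : ℕ, 1 / (n : ℝ) ^ (2 * w - 2 * k + 2))⁻¹ *
        ((∏ p ∈ S, (if (p : ℕ) ∣ N then (1 : ℝ) else (1 - (p : ℝ) ^ (-(2 * w - 2 * k + 2))))) /
          ∏ p ∈ S, (1 - (p : ℝ) ^ (-(2 * w - 2 * k + 2))))) *
      ((∑' n : ℕ, 1 / (n : ℝ) ^ (w - k + 1)) *
        ((∏ p ∈ S, (if (p : ℕ) ∣ N then (1 : ℝ) else (1 - (p : ℝ) ^ (-(w - k + 1)))⁻¹)) /
          ∏ p ∈ S, (1 - (p : ℝ) ^ (-(w - k + 1)))⁻¹)) with hVdef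
  -- the finite products, simplified and moved to `ℕ`-indexing
  have hg2 : ∏ p ∈ S, (if (p : ℕ) ∣ N then (1 : ℝ) else (1 - (p : ℝ) ^ (-(2 * w - 2 * k + 2)))) = 1 :=
    Finset.prod_eq_one fun p hp ↦ by rw [if_pos ((hS p).mpr hp)]
  have hg3 : ∏ p ∈ S, (if (p : ℕ) ∣ N then (1 : ℝ) else (1 - (p : ℝ) ^ (-(w - k + 1)))⁻¹) = 1 :=
    Finset.prod_eq_one fun p hp ↦ by rw [if_pos ((hS p).mpr hp)]
  have hmem : ∀ x ∈ N.primeFactors, x.Prime := fun x hx ↦ Nat.prime_of_mem_primeFactors hx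
  have hP1 : ∏ p ∈ S, (1 - ‖cuspCoeff f p‖ ^ 2 * (p : ℝ) ^ (-w))⁻¹ =
      (∏ p ∈ N.primeFactors, (1 - ‖cuspCoeff f p‖ ^ 2 * (p : ℝ) ^ (-w)))⁻¹ := by
    rw [prod_finset_primes_eq_prod_primeFactors hN hS'
      (fun q : ℕ ↦ (1 - ‖cuspCoeff f q‖ ^ 2 * (q : ℝ) ^ (-w))⁻¹), Finset.prod_inv_distrib]
  have hP2 : ∏ p ∈ S, (1 - (p : ℝ) ^ (-(2 * w - 2 * k + 2))) = ∏ p ∈ N.primeFactors, (1 - (p : ℝ) ^ (-(2 * w - 2 * k + 2))) :=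
    prod_finset_primes_eq_prod_primeFactors hN hS' (fun q : ℕ ↦ (1 - (q : ℝ) ^ (-(2 * w - 2 * k + 2))))
  have hP3 : ∏ p ∈ S, (1 - (p : ℝ) ^ (-(w - k + 1)))⁻¹ = (∏ p ∈ N.primeFactors, (1 - (p : ℝ) ^ (-(w - k + 1))))⁻¹ := by
    rw [prod_finset_primes_eq_prod_primeFactors hN hS' (fun q : ℕ ↦ (1 - (q : ℝ) ^ (-(w - k + 1)))⁻¹),
      Finset.prod_inv_distrib]
  -- nonvanishing of the three `ℕ`-indexed products
  have hB : 0 < ∏ p ∈ N.primeFactors, (1 - ‖cuspCoeff f p‖ ^ 2 * (p : ℝ) ^ (-w)) := by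
    refine Finset.prod_pos fun p hp ↦ ?_
    have h := hbad ⟨p, hmem p hp⟩ (Nat.dvd_of_mem_primeFactors hp)
    exact h
  have hB2 : 0 < ∏ p ∈ N.primeFactors, (1 - (p : ℝ) ^ (-(2 * w - 2 * k + 2))) := by
    refine Finset.prod_pos fun p hp ↦ ?_
    have h1 := hylt ⟨p, hmem p hp⟩
    have h2 := hypos ⟨p, hmem p hp⟩
    have h3 := hy2 ⟨p, hmem p hp⟩
    simp only at h1 h2 h3
    rw [h3]; nlinarith
  have hB3 : 0 < ∏ p ∈ N.primeFactors, (1 - (p : ℝ) ^ (-(w - k + 1))) := by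
    refine Finset.prod_pos fun p hp ↦ ?_
    have h1 := hylt ⟨p, hmem p hp⟩
    have h3 := hy ⟨p, hmem p hp⟩
    simp only at h1 h3
    rw [h3]; linarith
  have hV : V = ((∏ p ∈ N.primeFactors, (1 - ‖cuspCoeff f p‖ ^ 2 * (p : ℝ) ^ (-w))) *
      ((∑' n : ℕ, 1 / (n : ℝ) ^ (2 * w - 2 * k + 2)) * ∏ p ∈ N.primeFactors, (1 - (p : ℝ) ^ (-(2 * w - 2 * k + 2)))))⁻¹ *
      ((∑' n : ℕ, 1 / (n : ℝ) ^ (w - k + 1)) * ∏ p ∈ N.primeFactors, (1 - (p : ℝ) ^ (-(w - k + 1)))) := by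
    rw [hVdef, hg2, hg3, hP1, hP2, hP3]
    field_simp
  have hV0 : V ≠ 0 := by rw [hV]; positivity
  have hL := hE.mul (hasProd_inv_of_hasProd hc hV0)
  have hval : (∑' n : ℕ, ‖cuspCoeff f n‖ ^ 2 / (n : ℝ) ^ w) * V⁻¹ =
      (∑' n : ℕ, ‖cuspCoeff f n‖ ^ 2 / (n : ℝ) ^ w) *
        (∏ p ∈ N.primeFactors, (1 - ‖cuspCoeff f p‖ ^ 2 * (p : ℝ) ^ (-w))) *
        ((∑' n : ℕ, 1 / (n : ℝ) ^ (2 * w - 2 * k + 2)) * ∏ p ∈ N.primeFactors, (1 - (p : ℝ) ^ (-(2 * w - 2 * k + 2)))) /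
        ((∑' n : ℕ, 1 / (n : ℝ) ^ (w - k + 1)) * ∏ p ∈ N.primeFactors, (1 - (p : ℝ) ^ (-(w - k + 1)))) := by
    rw [hV]
    field_simp
  rw [hval] at hL
  refine hL.congr_fun fun p ↦ ?_
  by_cases hpN : (p : ℕ) ∣ N
  · simp only [if_pos hpN, mul_one]
    rw [inv_inv, inv_mul_cancel₀ (hbad p hpN).ne']
  · simp only [if_neg hpN, one_mul]
    have h1 := hQ p hpN
    have h2 := hylt p
    have h3 := hypos p
    rw [hy2 p, hy p]
    have h4 : (0 : ℝ) < 1 - ((p : ℕ) : ℝ) ^ ((k : ℝ) - 1) * ((p : ℕ) : ℝ) ^ (-w) := by linarith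
    have h5 : (0 : ℝ) < 1 + ((p : ℕ) : ℝ) ^ ((k : ℝ) - 1) * ((p : ℕ) : ℝ) ^ (-w) := by linarith
    have hq : (0 : ℝ) < 1 - (‖cuspCoeff f p‖ ^ 2 - 2 * ((p : ℕ) : ℝ) ^ ((k : ℝ) - 1)) * ((p : ℕ) : ℝ) ^ (-w) +
        (((p : ℕ) : ℝ) ^ ((k : ℝ) - 1)) ^ 2 * (((p : ℕ) : ℝ) ^ (-w)) ^ 2 :=
      (pos_iff_pos_of_mul_pos h1).mp h4
    have h6 : (1 : ℝ) - (((p : ℕ) : ℝ) ^ ((k : ℝ) - 1) * ((p : ℕ) : ℝ) ^ (-w)) ^ 2 =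
        (1 - ((p : ℕ) : ℝ) ^ ((k : ℝ) - 1) * ((p : ℕ) : ℝ) ^ (-w)) *
          (1 + ((p : ℕ) : ℝ) ^ ((k : ℝ) - 1) * ((p : ℕ) : ℝ) ^ (-w)) := by ring
    rw [h6, div_eq_mul_inv]
    field_simp


end SymmSquareWeight

section SymmSquareEdgeWeight

/-- The bad-prime factor at the edge, weight `k`: `∏_{p ∣ N} (1 − ‖a_p‖² p^{-k}) = ∏_{p ∥ N} (1 − p^{-2})`
(`‖a_p‖² = p^{k−2}` at `p ∥ N`, `= 0` at `p² ∣ N`). [cite: AtkinLehner1970, Thm. 3] -/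
theorem IsNewform0.prod_one_sub_normSq_cuspCoeff_mul_weight (hf : IsNewform0 f) :
    ∏ p ∈ N.primeFactors, (1 - ‖cuspCoeff f p‖ ^ 2 * (p : ℝ) ^ (-(k : ℝ))) =
      ∏ p ∈ N.primeFactors with ¬ p ^ 2 ∣ N, (1 - ((p : ℝ) ^ 2)⁻¹) := by
  rw [Finset.prod_filter]
  refine Finset.prod_congr rfl fun p hp ↦ ?_
  have hpr : p.Prime := Nat.prime_of_mem_primeFactors hp
  have hp0 : (0 : ℝ) < p := by exact_mod_cast hpr.pos
  rw [hf.norm_cuspCoeff_sq_of_dvd_weight hpr (Nat.dvd_of_mem_primeFactors hp)]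
  split_ifs with h2
  · simp
  · rw [← Real.rpow_add hp0, show (k : ℝ) - 2 + -(k : ℝ) = -(2 : ℝ) by ring,
      Real.rpow_neg (Nat.cast_nonneg p), Real.rpow_two]

/-- **The naive symmetric-square `L`-value of a newform of weight `k ≥ 1` at the edge of
convergence** (Rankin 1939; Shimura 1975/1976; Sturm 1980: `L(k, Sym² f) ∈ π^{k+1} (f,f) ℚ̄`; the
weight-`2` case is `IsNewform0.tendsto_tprod_symmSq`). As `w → k⁺` the product over the good
primes `p ∤ N` of the naive local symmetric-square factors
`((1 − q p^{-w})(1 − (a_p² − 2q) p^{-w} + q² p^{-2w}))⁻¹`, `q = p^{k−1}`, tends to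
`((4π)^k π/(2 Γ(k) N)) · ∏_{p ∥ N}(1 − p^{-2}) · Re ⟨f, f⟩` (`⟨f,f⟩ = peterssonProduct (Gamma0 N) k f f`,
un-normalised). Ingredients: the weight-`k` Rankin–Selberg residue
`(w − k) ∑ ‖aₙ‖² n^{-w} → 3 (4π)^k Re⟨f,f⟩/(π Γ(k) [SL₂(ℤ):Γ₀(N)])`
(`tendsto_sub_weight_mul_tsum_normSq_cuspCoeff_div_rpow`), `hasProd_symmSq_weight`,
`(s − 1)ζ(s) → 1`, `ζ(2) = π²/6`, `[SL₂(ℤ):Γ₀(N)] = N∏_{p∣N}(1 + 1/p)` and `‖a_p‖² = p^{k−2}` at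
`p ∥ N`. [cite: Bump1997, Thm. 1.6.2 with §3.9 (PDF pp. 72, 382)] -/
theorem IsNewform0.tendsto_tprod_symmSq_weight (hk : 1 ≤ k) (hf : IsNewform0 f) :
    Tendsto (fun w : ℝ ↦ ∏' p : Nat.Primes, (if (p : ℕ) ∣ N then (1 : ℝ) else
        ((1 - (p : ℝ) ^ ((k : ℝ) - 1) * (p : ℝ) ^ (-w)) *
          (1 - (‖cuspCoeff f p‖ ^ 2 - 2 * (p : ℝ) ^ ((k : ℝ) - 1)) * (p : ℝ) ^ (-w) +
            ((p : ℝ) ^ ((k : ℝ) - 1)) ^ 2 * ((p : ℝ) ^ (-w)) ^ 2))⁻¹))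
      (𝓝[>] (k : ℝ))
      (𝓝 ((4 * π) ^ k * π / (2 * Real.Gamma k * N) *
        (∏ p ∈ N.primeFactors with ¬ p ^ 2 ∣ N, (1 - ((p : ℝ) ^ 2)⁻¹)) *
        (peterssonProduct (Gamma0 N) k f f).re)) := by
  have hN : N ≠ 0 := NeZero.ne N
  have hNpos : (0 : ℝ) < N := by exact_mod_cast NeZero.pos N
  have hk0 : (0 : ℝ) < k := by exact_mod_cast hk
  have hkz : (0 : ℤ) ≤ k := by omega
  have hmem : ∀ p ∈ N.primeFactors, (0 : ℝ) < p ∧ (1 : ℝ) < p := fun p hp ↦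
    ⟨by exact_mod_cast (Nat.prime_of_mem_primeFactors hp).pos,
      by exact_mod_cast (Nat.prime_of_mem_primeFactors hp).one_lt⟩
  -- (1) the Rankin–Selberg residue
  have hD := tendsto_sub_weight_mul_tsum_normSq_cuspCoeff_div_rpow hk f
  -- (2) the bad-prime factor is continuous at `w = k`
  have hB : Tendsto (fun w : ℝ ↦ ∏ p ∈ N.primeFactors, (1 - ‖cuspCoeff f p‖ ^ 2 * (p : ℝ) ^ (-w)))
      (𝓝[>] (k : ℝ)) (𝓝 (∏ p ∈ N.primeFactors, (1 - ‖cuspCoeff f p‖ ^ 2 * (p : ℝ) ^ (-(k : ℝ))))) := by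
    refine tendsto_nhdsWithin_of_tendsto_nhds (tendsto_finsetProd _ fun p hp ↦ ?_)
    exact tendsto_const_nhds.sub (tendsto_const_nhds.mul
      ((Real.continuousAt_const_rpow (hmem p hp).1.ne').tendsto.comp (continuous_neg.tendsto (k : ℝ))))
  -- (3) `ζ_N(2w − 2k + 2) → ζ_N(2) = (π²/6) ∏_{p∣N} (1 − p^{-2})`
  have hZ2 : Tendsto (fun w : ℝ ↦ (∑' n : ℕ, 1 / (n : ℝ) ^ (2 * w - 2 * k + 2)) *
        ∏ p ∈ N.primeFactors, (1 - (p : ℝ) ^ (-(2 * w - 2 * k + 2)))) (𝓝[>] (k : ℝ))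
      (𝓝 (π ^ 2 / 6 * ∏ p ∈ N.primeFactors, (1 - (p : ℝ) ^ (-(2 : ℝ))))) := by
    refine tendsto_nhdsWithin_of_tendsto_nhds ?_
    have ha : Tendsto (fun w : ℝ ↦ 2 * w - 2 * k + 2) (𝓝 (k : ℝ)) (𝓝 2) := by
      have hc : Continuous fun w : ℝ ↦ 2 * w - 2 * k + 2 := by fun_prop
      exact hc.tendsto' (k : ℝ) 2 (by simp)
    have h1 : Tendsto (fun w : ℝ ↦ ∑' n : ℕ, 1 / (n : ℝ) ^ (2 * w - 2 * k + 2)) (𝓝 (k : ℝ))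
        (𝓝 (π ^ 2 / 6)) := by
      rw [← tsum_one_div_nat_rpow_two]
      exact (continuousAt_tsum_one_div_nat_rpow (s := 2) (by norm_num)).tendsto.comp ha
    have h2 : Tendsto (fun w : ℝ ↦ ∏ p ∈ N.primeFactors, (1 - (p : ℝ) ^ (-(2 * w - 2 * k + 2))))
        (𝓝 (k : ℝ)) (𝓝 (∏ p ∈ N.primeFactors, (1 - (p : ℝ) ^ (-(2 : ℝ))))) :=
      tendsto_finsetProd _ fun p hp ↦ tendsto_const_nhds.sub
        ((Real.continuousAt_const_rpow (hmem p hp).1.ne').tendsto.comp ha.neg)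
    exact h1.mul h2
  -- (4) `(w − k) ζ_N(w − k + 1) → ∏_{p∣N} (1 − p^{-1})`
  have hZ1 : Tendsto (fun w : ℝ ↦ (w - k) * ((∑' n : ℕ, 1 / (n : ℝ) ^ (w - k + 1)) *
        ∏ p ∈ N.primeFactors, (1 - (p : ℝ) ^ (-(w - k + 1))))) (𝓝[>] (k : ℝ))
      (𝓝 (1 * ∏ p ∈ N.primeFactors, (1 - (p : ℝ) ^ (-(1 : ℝ))))) := by
    have hmap : Tendsto (fun w : ℝ ↦ w - k + 1) (𝓝[>] (k : ℝ)) (𝓝[>] 1) := by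
      have hc : Continuous fun w : ℝ ↦ w - k + 1 := (continuous_sub_right (k : ℝ)).add continuous_const
      have h := (hc.continuousWithinAt (s := Set.Ioi (k : ℝ)) (x := (k : ℝ))).tendsto_nhdsWithin
        (t := Set.Ioi (1 : ℝ)) (fun w hw ↦ by simp only [Set.mem_Ioi] at hw ⊢; linarith)
      rw [show (k : ℝ) - k + 1 = 1 by ring] at h
      exact h
    have h1 : Tendsto (fun w : ℝ ↦ (w - k) * ∑' n : ℕ, 1 / (n : ℝ) ^ (w - k + 1)) (𝓝[>] (k : ℝ))
        (𝓝 1) := by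
      refine (tendsto_sub_one_mul_tsum_one_div_nat_rpow.comp hmap).congr fun w ↦ ?_
      simp only [Function.comp_apply]
      congr 1
      ring
    have h2 : Tendsto (fun w : ℝ ↦ ∏ p ∈ N.primeFactors, (1 - (p : ℝ) ^ (-(w - k + 1)))) (𝓝[>] (k : ℝ))
        (𝓝 (∏ p ∈ N.primeFactors, (1 - (p : ℝ) ^ (-(1 : ℝ))))) := by
      refine tendsto_nhdsWithin_of_tendsto_nhds ?_
      have ha : Tendsto (fun w : ℝ ↦ -(w - k + 1)) (𝓝 (k : ℝ)) (𝓝 (-1)) := by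
        have hc : Continuous fun w : ℝ ↦ -(w - k + 1) := by fun_prop
        exact hc.tendsto' (k : ℝ) (-1) (by simp)
      exact tendsto_finsetProd _ fun p hp ↦ tendsto_const_nhds.sub
        ((Real.continuousAt_const_rpow (hmem p hp).1.ne').tendsto.comp ha)
    have h := h1.mul h2
    refine h.congr fun w ↦ ?_
    ring
  -- (5) nonvanishing of the denominator limit and combination
  have hP1 : 0 < ∏ p ∈ N.primeFactors, (1 - (p : ℝ) ^ (-(1 : ℝ))) := by
    refine Finset.prod_pos fun p hp ↦ ?_
    rw [Real.rpow_neg_one]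
    have h := (hmem p hp).2
    have : (p : ℝ)⁻¹ < 1 := inv_lt_one_of_one_lt₀ h
    linarith
  have hlim : Tendsto (fun w : ℝ ↦ (w - k) * (∑' n : ℕ, ‖cuspCoeff f n‖ ^ 2 / (n : ℝ) ^ w) *
      (∏ p ∈ N.primeFactors, (1 - ‖cuspCoeff f p‖ ^ 2 * (p : ℝ) ^ (-w))) *
      ((∑' n : ℕ, 1 / (n : ℝ) ^ (2 * w - 2 * k + 2)) * ∏ p ∈ N.primeFactors, (1 - (p : ℝ) ^ (-(2 * w - 2 * k + 2)))) /
      ((w - k) * ((∑' n : ℕ, 1 / (n : ℝ) ^ (w - k + 1)) * ∏ p ∈ N.primeFactors, (1 - (p : ℝ) ^ (-(w - k + 1))))))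
      (𝓝[>] (k : ℝ)) (𝓝 (3 * (peterssonProduct (Gamma0 N) k f f).re / (π * gamma0Index N) *
        ((4 * π) ^ k / Real.Gamma k) *
        (∏ p ∈ N.primeFactors, (1 - ‖cuspCoeff f p‖ ^ 2 * (p : ℝ) ^ (-(k : ℝ)))) *
        (π ^ 2 / 6 * ∏ p ∈ N.primeFactors, (1 - (p : ℝ) ^ (-(2 : ℝ)))) /
        (1 * ∏ p ∈ N.primeFactors, (1 - (p : ℝ) ^ (-(1 : ℝ)))))) :=
    ((hD.mul hB).mul hZ2).div hZ1 (by positivity)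
  -- (6) the value
  have hval : 3 * (peterssonProduct (Gamma0 N) k f f).re / (π * gamma0Index N) *
        ((4 * π) ^ k / Real.Gamma k) *
        (∏ p ∈ N.primeFactors, (1 - ‖cuspCoeff f p‖ ^ 2 * (p : ℝ) ^ (-(k : ℝ)))) *
        (π ^ 2 / 6 * ∏ p ∈ N.primeFactors, (1 - (p : ℝ) ^ (-(2 : ℝ)))) /
        (1 * ∏ p ∈ N.primeFactors, (1 - (p : ℝ) ^ (-(1 : ℝ)))) =
      (4 * π) ^ k * π / (2 * Real.Gamma k * N) *
        (∏ p ∈ N.primeFactors with ¬ p ^ 2 ∣ N, (1 - ((p : ℝ) ^ 2)⁻¹)) *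
        (peterssonProduct (Gamma0 N) k f f).re := by
    rw [← hf.prod_one_sub_normSq_cuspCoeff_mul_weight, gamma0Index_eq_mul_prod hN]
    have hΓ : Real.Gamma k ≠ 0 := (Real.Gamma_pos_of_pos hk0).ne'
    have hπ : (π : ℝ) ≠ 0 := Real.pi_ne_zero
    have hP2 : ∏ p ∈ N.primeFactors, (1 - (p : ℝ) ^ (-(2 : ℝ))) =
        (∏ p ∈ N.primeFactors, (1 - (p : ℝ) ^ (-(1 : ℝ)))) * ∏ p ∈ N.primeFactors, (1 + (p : ℝ)⁻¹) := by
      rw [← Finset.prod_mul_distrib]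
      refine Finset.prod_congr rfl fun p hp ↦ ?_
      rw [Real.rpow_neg_one, Real.rpow_neg (Nat.cast_nonneg p), Real.rpow_two]
      ring
    have hQ : 0 < ∏ p ∈ N.primeFactors, (1 + (p : ℝ)⁻¹) :=
      Finset.prod_pos fun p hp ↦ by have := (hmem p hp).1; positivity
    rw [hP2]
    field_simp
    ring
  rw [hval] at hlim
  refine hlim.congr' ?_
  filter_upwards [self_mem_nhdsWithin] with w hw
  simp only [Set.mem_Ioi] at hw
  have hw2 : w - k ≠ 0 := by linarith
  have hZ1w : 0 < ∑' n : ℕ, 1 / (n : ℝ) ^ (w - k + 1) := tsum_one_div_nat_rpow_pos (by linarith)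
  have hP1w : 0 < ∏ p ∈ N.primeFactors, (1 - (p : ℝ) ^ (-(w - k + 1))) := by
    refine Finset.prod_pos fun p hp ↦ ?_
    have h : (p : ℝ) ^ (-(w - k + 1)) < 1 :=
      Real.rpow_lt_one_of_one_lt_of_neg (hmem p hp).2 (by linarith)
    linarith
  rw [(hf.hasProd_symmSq_weight hkz hw).tprod_eq]
  field_simp


end SymmSquareEdgeWeight

end Literature.NumberTheory.EllipticCurves.ModularForms

end
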